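import Mathlib

/-!
# Route «KPlusLogSqLaw», crux `WeakLifting` (stmt-ValiantsHypothesis-19561) — half-turn strip count, door (A′):
# THE FORMAL ROTATION INEQUALITY (uniform in the top speed `Λ`; kernel core of THEOREM T4)

HONEST FRAMING.  Helper lemmas (`--supports stmt-ValiantsHypothesis-19561 --as helper`), seat pub-symmetroid-conjb-2 (g15), cell `pub-symmetroid`,
2026-08-28.  Pure integer bookkeeping (`omega`); nothing here is an upper bound on any root count by itself and nothing bears on `WeakLifting` /
`TropicalB` (stmt-19771) in their windows, on Conjecture B (`KPlusLogSqLaw`), on the Door-A registers, on `MatrixDescartes` (stmt-18050) or on VP ≠ VNP.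

CONTEXT (paper: cell deposit HOME/pub-symmetroid-conjb-2/g15/theory/THEORY-NOTE-g15.md §5–§5c).  A definite static tridiagonal design with signed
edge slopes `L_k ∈ {±1,…,±Λ}` and weights `a_k > 0` has continuant `Q = p_m`, `p₀ = p₁ = 1`, `p_{k+1} = p_k − a_k x^{L_k} p_{k−1}`.  Write
`e₁(p)`/`e₀(p)` for the top/bottom exponent, `d_k := e₁(p_k) − e₁(p_{k−1}) ≥ 0`, `σ_k := [top-coefficient ratio of p_k : p_{k−1} is > 0]`,
`e_k := e₀(p_k) − e₀(p_{k−1}) ≤ 0`, `τ_k` likewise for bottom coefficients.  For generic weights these obey the transitions `topStep` / `botStep`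
below (`d_{k+1} = max(0, L_k − d_k)`; the sign flips when the edge term wins, is `+` when it loses, and is free on a tie with `σ_k = +`).  On the ray
`x = ω e^{iπ/Λ}` (the boundary of the HALF-TURN strip `|arg x| < π/Λ`) the ratio `r_k = p_k/p_{k−1}` has limiting directions `topDir Λ d_k σ_k · π/Λ`
(`ω → ∞`) and `botDir Λ e_k τ_k · π/Λ` (`ω → 0⁺`).  THEOREM T4 (paper, §5b): if the word is SECTOR-COHERENT (the sector automaton of §5b never
dies) then every `r_k` is confined to an open sector of opening `< 2π`, so `−Δarg r_k = (botDir − topDir)·π/Λ` EXACTLY, and the inequality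
`formal_rotation_le` proved here (valid for EVERY word, coherent or not) gives `−θ_Λ ≤ (π/Λ) Σ_k (Λ − |L_k|)`, whence the half-turn count
`ρ_Λ = n/Λ − θ_Λ/π ≤ (n + Σ_k (Λ − |L_k|))/Λ ≤ m − 1` (since `n ≤ Σ_k |L_k|`).  For incoherent words the true rotation differs from the formal one by
`2π·W`, `W ∈ ℤ` (§5c: the open core is the winding budget).  The potential is `carry = d[σ] + |e|[τ]`; the one-step inequality is `formal_step`.
[this seat]
-/

-- `Summit.ValiantsHypothesis.ValiantsHypothesis.…` repeats a component by the D-0017 layout (single-conjunct summit); the name is mandated.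
set_option linter.dupNamespace false

namespace Summit.ValiantsHypothesis.ValiantsHypothesis.Theorems.KPlusLogSqLaw.FormalRotation

/-- top exponent-jump / sign transition under an edge of signed slope `L`: `(d, σ) ↦ (d₂, σ₂)` (Boolean checker; the tie with `σ = +` is free). -/
def topStep (L d : ℤ) (σ : Bool) (d₂ : ℤ) (σ₂ : Bool) : Bool :=
  (decide (L - d < 0) && decide (d₂ = 0) && σ₂) ||
  (decide (0 < L - d) && decide (d₂ = L - d) && (σ₂ == !σ)) ||
  (decide (L - d = 0) && decide (d₂ = 0) && (σ || σ₂))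

/-- bottom exponent-jump / sign transition: `(e, τ) ↦ (e₂, τ₂)` (mirror image of `topStep`). -/
def botStep (L e : ℤ) (τ : Bool) (e₂ : ℤ) (τ₂ : Bool) : Bool :=
  (decide (0 < L - e) && decide (e₂ = 0) && τ₂) ||
  (decide (L - e < 0) && decide (e₂ = L - e) && (τ₂ == !τ)) ||
  (decide (L - e = 0) && decide (e₂ = 0) && (τ || τ₂))

/-- formal direction of `r_k` at `ω → ∞` on the ray `arg x = π/Λ`, in units of `π/Λ`. -/
def topDir (Λ d : ℤ) (σ : Bool) : ℤ := if σ then d else d - Λ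

/-- formal direction of `r_k` at `ω → 0⁺`, in units of `π/Λ`. -/
def botDir (Λ e : ℤ) (τ : Bool) : ℤ := if τ then e else e + Λ

/-- the carry potential `Φ = d·[σ] + |e|·[τ]` (recall `e ≤ 0`). -/
def carry (d : ℤ) (σ : Bool) (e : ℤ) (τ : Bool) : ℤ := (if σ then d else 0) + (if τ then -e else 0)

/-- `topStep` keeps the top jump nonnegative. -/
theorem topStep_nonneg {L d d₂ : ℤ} {σ σ₂ : Bool} (h : topStep L d σ d₂ σ₂ = true) : 0 ≤ d₂ := by
  unfold topStep at h
  cases σ <;> cases σ₂ <;> simp at h <;> omega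

/-- `botStep` keeps the bottom jump nonpositive. -/
theorem botStep_nonpos {L e e₂ : ℤ} {τ τ₂ : Bool} (h : botStep L e τ e₂ τ₂ = true) : e₂ ≤ 0 := by
  unfold botStep at h
  cases τ <;> cases τ₂ <;> simp at h <;> omega

/-- THE ONE-STEP FORMAL ROTATION INEQUALITY: the formal negative rotation `botDir − topDir` of the new ratio plus the span `|L|` of the edge is at
most `Λ` plus the drop of the carry potential.  All sixteen sign patterns reduce to linear integer arithmetic. -/
theorem formal_step {Λ L d e d₂ e₂ : ℤ} {σ τ σ₂ τ₂ : Bool}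
    (hL₁ : -Λ ≤ L) (hL₂ : L ≤ Λ) (hL : L ≠ 0) (hd : 0 ≤ d) (he : e ≤ 0)
    (ht : topStep L d σ d₂ σ₂ = true) (hb : botStep L e τ e₂ τ₂ = true) :
    botDir Λ e₂ τ₂ - topDir Λ d₂ σ₂ + |L| ≤ Λ + carry d σ e τ - carry d₂ σ₂ e₂ τ₂ := by
  unfold topStep at ht
  unfold botStep at hb
  unfold botDir topDir carry
  rcases lt_or_gt_of_ne hL with hL' | hL'
  · rw [abs_of_neg hL']
    cases σ <;> cases τ <;> cases σ₂ <;> cases τ₂ <;> simp at ht hb ⊢ <;> omega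
  · rw [abs_of_pos hL']
    cases σ <;> cases τ <;> cases σ₂ <;> cases τ₂ <;> simp at ht hb ⊢ <;> omega

/-- a formal run: from state `(d, σ, e, τ)` the list of steps `(L, d₂, σ₂, e₂, τ₂)` is admissible (`0 < |L| ≤ Λ`, both transitions hold). -/
def runOK (Λ : ℤ) : ℤ → Bool → ℤ → Bool → List (ℤ × ℤ × Bool × ℤ × Bool) → Bool
  | _, _, _, _, [] => true
  | d, σ, e, τ, (L, d₂, σ₂, e₂, τ₂) :: rest =>
      decide (-Λ ≤ L) && decide (L ≤ Λ) && decide (L ≠ 0) && topStep L d σ d₂ σ₂ && botStep L e τ e₂ τ₂ && runOK Λ d₂ σ₂ e₂ τ₂ rest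

/-- total formal negative rotation `Σ (botDir − topDir)` of a run, in units of `π/Λ`. -/
def negRot (Λ : ℤ) : List (ℤ × ℤ × Bool × ℤ × Bool) → ℤ
  | [] => 0
  | (_, d₂, σ₂, e₂, τ₂) :: rest => (botDir Λ e₂ τ₂ - topDir Λ d₂ σ₂) + negRot Λ rest

/-- the budget `Σ (Λ − |L|)` of a run, in units of `π/Λ`. -/
def budget (Λ : ℤ) : List (ℤ × ℤ × Bool × ℤ × Bool) → ℤ
  | [] => 0
  | (L, _, _, _, _) :: rest => (Λ - |L|) + budget Λ rest

/-- the carry of the final state of a run started at `(d, σ, e, τ)`. -/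
def lastCarry : ℤ → Bool → ℤ → Bool → List (ℤ × ℤ × Bool × ℤ × Bool) → ℤ
  | d, σ, e, τ, [] => carry d σ e τ
  | _, _, _, _, (_, d₂, σ₂, e₂, τ₂) :: rest => lastCarry d₂ σ₂ e₂ τ₂ rest

/-- the carry is nonnegative on admissible states. -/
theorem carry_nonneg {d e : ℤ} {σ τ : Bool} (hd : 0 ≤ d) (he : e ≤ 0) : 0 ≤ carry d σ e τ := by
  unfold carry; cases σ <;> cases τ <;> simp <;> omega

/-- the final carry of an admissible run is nonnegative. -/
theorem lastCarry_nonneg {Λ : ℤ} (steps : List (ℤ × ℤ × Bool × ℤ × Bool)) :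
    ∀ {d e : ℤ} {σ τ : Bool}, 0 ≤ d → e ≤ 0 → runOK Λ d σ e τ steps = true → 0 ≤ lastCarry d σ e τ steps := by
  induction steps with
  | nil => intro d e σ τ hd he _; exact carry_nonneg hd he
  | cons st rest ih =>
      intro d e σ τ hd he h
      obtain ⟨L, d₂, σ₂, e₂, τ₂⟩ := st
      simp only [runOK, Bool.and_eq_true, decide_eq_true_eq] at h
      obtain ⟨⟨⟨⟨⟨_, _⟩, _⟩, ht⟩, hb⟩, hr⟩ := h
      exact ih (topStep_nonneg ht) (botStep_nonpos hb) hr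

/-- TELESCOPED FORM: along an admissible run, formal negative rotation + final carry ≤ budget + initial carry. -/
theorem negRot_add_lastCarry_le {Λ : ℤ} (steps : List (ℤ × ℤ × Bool × ℤ × Bool)) :
    ∀ {d e : ℤ} {σ τ : Bool}, 0 ≤ d → e ≤ 0 → runOK Λ d σ e τ steps = true →
      negRot Λ steps + lastCarry d σ e τ steps ≤ budget Λ steps + carry d σ e τ := by
  induction steps with
  | nil => intro d e σ τ _ _ _; simp [negRot, lastCarry, budget]
  | cons st rest ih =>
      intro d e σ τ hd he h
      obtain ⟨L, d₂, σ₂, e₂, τ₂⟩ := st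
      simp only [runOK, Bool.and_eq_true, decide_eq_true_eq] at h
      obtain ⟨⟨⟨⟨⟨hL₁, hL₂⟩, hL⟩, ht⟩, hb⟩, hr⟩ := h
      have hstep := formal_step hL₁ hL₂ hL hd he ht hb
      have hrest := ih (topStep_nonneg ht) (botStep_nonpos hb) hr
      simp only [negRot, lastCarry, budget]
      linarith

/-- THE FORMAL ROTATION INEQUALITY: for every admissible run from the initial state `(0, +, 0, +)` (i.e. `p₁/p₀ = 1`),
`Σ_k (botDir − topDir) ≤ Σ_k (Λ − |L_k|)`.  For sector-coherent words the left side is `−θ_Λ·Λ/π` (paper, T4), giving `ρ_Λ ≤ m − 1`. -/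
theorem formal_rotation_le {Λ : ℤ} (steps : List (ℤ × ℤ × Bool × ℤ × Bool)) (h : runOK Λ 0 true 0 true steps = true) :
    negRot Λ steps ≤ budget Λ steps := by
  have h₁ := negRot_add_lastCarry_le steps le_rfl le_rfl h
  have h₂ := lastCarry_nonneg (Λ := Λ) steps le_rfl le_rfl h
  simp [carry] at h₁
  linarith

/-- sanity instance (`Λ = 2`, the alternating slow word `(+1, −1, +1)` with its forced jumps/signs): formal negative rotation `3 = budget 3`
— the quarter-turn law of T3 (`−θ ≤ s·π/2`) is attained formally; for `(+1, +1, +1)` the formal value is only `2`. -/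
example : negRot 2 [(1, 1, false, 0, true), (-1, 0, true, -1, false), (1, 1, false, 0, true)] = 3 ∧
    budget 2 [(1, 1, false, 0, true), (-1, 0, true, -1, false), (1, 1, false, 0, true)] = 3 ∧
    runOK 2 0 true 0 true [(1, 1, false, 0, true), (-1, 0, true, -1, false), (1, 1, false, 0, true)] = true ∧
    negRot 2 [(1, 1, false, 0, true), (1, 0, true, 0, true), (1, 1, false, 0, true)] = 2 ∧
    runOK 2 0 true 0 true [(1, 1, false, 0, true), (1, 0, true, 0, true), (1, 1, false, 0, true)] = true := by decide

end Summit.ValiantsHypothesis.ValiantsHypothesis.Theorems.KPlusLogSqLaw.FormalRotation
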